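import Mathlib.GroupTheory.Torsion
import Mathlib.RingTheory.RootsOfUnity.Basic
import Mathlib.GroupTheory.QuotientGroup.Defs
import Mathlib.Algebra.GroupWithZero.Associated
import Mathlib.Algebra.Group.End
import Mathlib.Data.NNReal.Basic
import Mathlib.Tactic.Linarith
import Mathlib.Algebra.BigOperators.Group.Finset.Basic
import Mathlib.Algebra.Category.MonCat.Basic
import Mathlib.Algebra.Category.Grp.Basic
import Literature.IUT.HodgeArakelov.KummerStructures

/-!
# [IUTchII] Definition 4.9 (ii)–(viii): `O^⊥`, `O^▶`, `O^{▶×μ}`, split-Kummer Frobenioids,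
# `F^{⊢×}`-, `F^{⊢×μ}`-, `F^{⊢▶×μ}`-prime-strips, `F^{⊩▶×μ}`-prime-strips and the pilot object

S. Mochizuki, *Inter-universal Teichmüller theory II*, §4, Definition 4.9 (ii)–(viii) (kurims
Dec-2020 manuscript pp. 155–158) [cite: Mochizuki2012, Def 4.9 (ii) p.155]. Claim key DISPUTED
(D-0012): definitions, interfaces and Prop-valued statements only; nothing asserted.

**What is printed** is quoted verbatim, item by item, in the docstrings below (Def 4.9 (ii) `O^⊥`,
`O^▶ := O^⊥/μ_{2l}` with "[so we have a natural isomorphism `O^▷(‡A)/O^×(‡A) ⥲ O^▶(‡A)`]", `O^{▶×μ}`,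
`‡κ^{⊢×}_w`, `‡κ^{⊢×μ}_w`; (iii)–(iv) the split-`×μ`- and split-`×`-Kummer Frobenioids at bad / good places; (v) the
archimedean inductive system `O^{×μ_N}(A)`; (vi)–(vii) `F^{⊢×}`-, `F^{⊢×μ}`-, `F^{⊢▶×μ}`-prime-strips; (viii)
`F^{⊩▶×μ}`-prime-strips and the pilot object of negative arithmetic degree).

**Dictionary.** `O^▷(‡A)` is a `CommMonoid O` with `‡G`-action `G →* MulAut O` (topologies
suppressed); `μ_N = rootsOfUnity N O`; `O^{×μ} = Oˣ ⧸ CommGroup.torsion Oˣ`; `O^{×μ_N} = Oˣ ⧸ μ_N` (`UnitsModRoots`, `UnitsModTorsion` of `KummerStructures`);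
`O^▶(‡A)` is DEFINED as Mathlib's `Associates O = O^▷/O^×`, the right-hand side of the printed
natural isomorphism, and `O^⊥` is the real submonoid generated by `μ_{2l}` and the splitting image;
that `O^⊥/μ_{2l} ⥲ O^▷/O^×` is recorded as the statement `OPerpPresentsAssociates` (it is the content
of "split Frobenioid" at bad `w`, [IUTchI] Ex 3.2 (v)). The Kummer structures `‡κ^{⊢×}_w`, `‡κ^{⊢×μ}_w`
are the REAL `KummerTimes` / `KummerTimesMu` of this seat's `KummerStructures` (Def 4.9 (i), imported;
v2, gate lesson G3), over the group-theoretic units `GroupTheoreticUnits` of Example 1.8 (iii); the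
model/realified Frobenioids ([FrdI] Thm 5.2 / [IUTchI] Def 5.2 (iv), abc-iut-L1-t2 / abc-iut-L5-t4) remain
interfaces — TODO-merge. PROVED: the transition
maps of (v) and their surjectivity; `μ_{2l} ⊆ O^⊥`, splitting image `⊆ O^⊥`; the pilot object has
negative degree (from its printed description). v2 (review q9917164): `2l`/`1` forced by the place
type (`torsionOrder`), no junk `conditions : Prop` field, `rho` a monoid homomorphism tied to the
pilot's local degrees, strip isomorphisms as `Equiv`-data (`FVdashTriMuIso`), quotients via
`KummerStructures`; carriers are Mathlib's bundled `CommMonCat`/`CommGrpCat`.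
-/

namespace Literature.IUT.HodgeArakelov

open scoped BigOperators

universe u v w

/-! ### 1. Definition 4.9 (ii), (iv): `O^⊥`, `O^▶`, `O^{▶×μ}` (pp. 155–156) -/

section LocalMonoids

variable (O : Type u) [CommMonoid O]

/-- `O^⊥(‡A) ⊆ O^▷(‡A)` at `w ∈ V^bad`: the submonoid generated by the `2l`-torsion units `μ_{2l}(‡A)` and
"the images of the splittings with which `‡F^⊢_w` is equipped" ([IUTchII] Def 4.9 (ii) p. 155); at
`w ∈ V^good ∩ V^non` one takes instead `twoL := 1` (no torsion adjoined: Def 4.9 (iv) p. 156,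
"`O^⊥(‡A) :=` the image of the splitting"). [cite: Mochizuki2012, Def 4.9 (ii) p.155] -/
def OPerp (twoL : ℕ) (splitting : Submonoid O) : Submonoid O :=
  ((rootsOfUnity twoL O).toSubmonoid.map (Units.coeHom O)) ⊔ splitting

/-- `μ_{2l}(‡A) ⊆ O^⊥(‡A)` ([IUTchII] Def 4.9 (ii) p. 155). [cite: Mochizuki2012, Def 4.9 (ii) p.155] -/
theorem rootsOfUnity_mem_OPerp (twoL : ℕ) (splitting : Submonoid O) (ζ : Oˣ)
    (hζ : ζ ∈ rootsOfUnity twoL O) : (ζ : O) ∈ OPerp O twoL splitting :=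
  Submonoid.mem_sup_left ⟨ζ, hζ, rfl⟩

/-- The splitting image lies in `O^⊥(‡A)` ([IUTchII] Def 4.9 (ii) p. 155).
[cite: Mochizuki2012, Def 4.9 (ii) p.155] -/
theorem splitting_le_OPerp (twoL : ℕ) (splitting : Submonoid O) :
    splitting ≤ OPerp O twoL splitting := le_sup_right

/-- At a good nonarchimedean place `O^⊥(‡A)` IS the splitting image (Def 4.9 (iv) p. 156): with
`twoL = 1` no roots of unity are adjoined. [cite: Mochizuki2012, Def 4.9 (iv) p.156] -/
theorem OPerp_one (splitting : Submonoid O) : OPerp O 1 splitting = splitting := by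
  unfold OPerp
  refine le_antisymm (sup_le ?_ le_rfl) le_sup_right
  rintro _ ⟨ζ, hζ, rfl⟩
  have : ζ = 1 := by simpa [mem_rootsOfUnity] using hζ
  simp [this]

/-- `O^▶(‡A)`: by the printed "natural isomorphism `O^▷(‡A)/O^×(‡A) ⥲ O^▶(‡A)`" ([IUTchII] Def 4.9
(ii) p. 155) we record `O^▶` as Mathlib's `Associates O = O^▷/O^×` (the quotient by the unit
group); the printed presentation `O^⊥(‡A)/μ_{2l}(‡A)` is `OPerpPresentsAssociates` below. At good
`w`, "`O^▶(‡A) := O^⊥(‡A)`" (Def 4.9 (iv) p. 156) maps isomorphically onto it for a split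
Frobenioid. [cite: Mochizuki2012, Def 4.9 (ii) p.155] -/
abbrev OTri : Type u := Associates O

/-- `O^{▶×μ}(‡A) := O^▶(‡A) × O^{×μ}(‡A)`, "the direct product monoid" ([IUTchII] Def 4.9 (ii) p. 155,
(iv) p. 156). [cite: Mochizuki2012, Def 4.9 (ii) p.155] -/
abbrev OTriTimesMu : Type u := Associates O × UnitsModTorsion O

/-- The projection `O^▷ ↠ O^▷/O^× = O^▶` ([IUTchII] Def 4.9 (ii) p. 155). [cite: Mochizuki2012, Def 4.9 (ii) p.155] -/
def toOTri : O →* OTri O := Associates.mkMonoidHom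

/-- STATEMENT (content of "split Frobenioid" at a bad place, [IUTchI] Ex 3.2 (v); the bracket
"[so we have a natural isomorphism `O^▷(‡A)/O^×(‡A) ⥲ O^▶(‡A)`]" of Def 4.9 (ii) p. 155): the
composite `O^⊥ ↪ O^▷ ↠ O^▷/O^×` is surjective and identifies exactly the `μ_{2l}`-multiples, i.e.
presents `O^▶ = O^⊥/μ_{2l}`. Recorded as a Prop on the splitting data; not asserted.
[cite: Mochizuki2012, Def 4.9 (ii) p.155] -/
def OPerpPresentsAssociates (twoL : ℕ) (splitting : Submonoid O) : Prop :=
  (∀ a : OTri O, ∃ x ∈ OPerp O twoL splitting, toOTri O x = a) ∧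
  (∀ x ∈ OPerp O twoL splitting, ∀ y ∈ OPerp O twoL splitting,
    toOTri O x = toOTri O y ↔ ∃ ζ : Oˣ, ζ ∈ rootsOfUnity twoL O ∧ x = ζ * y)

end LocalMonoids

/-! ### 2. Definition 4.9 (v): the archimedean inductive system `O^{×μ_N}` (p. 157) -/

section Archimedean

/-- The transition surjection `O^{×μ_N}(A) ↠ O^{×μ_M}(A)` for `N ∣ M` of the inductive system
"`… ↠ O^{×μ_N}(A) ↠ … ↠ O^{×μ_{N·N'}}(A) ↠ …`" ([IUTchII] Def 4.9 (v) p. 157), on the quotients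
`UnitsModRoots` of Def 4.9 (i) (`KummerStructures`). [cite: Mochizuki2012, Def 4.9 (v) p.157] -/
def unitsModRootsTransition (O : Type u) [CommMonoid O] {N M : ℕ} (h : N ∣ M) :
    UnitsModRoots O N →* UnitsModRoots O M :=
  QuotientGroup.map _ _ (MonoidHom.id _)
    (by simpa only [Subgroup.comap_id] using rootsOfUnity_le_of_dvd h)

/-- The transition maps are surjective ([IUTchII] Def 4.9 (v) p. 157 "`↠`").
[cite: Mochizuki2012, Def 4.9 (v) p.157] -/
theorem unitsModRootsTransition_surjective (O : Type u) [CommMonoid O] {N M : ℕ} (h : N ∣ M) :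
    Function.Surjective (unitsModRootsTransition O h) := by
  intro x
  induction x using QuotientGroup.induction_on with
  | H z => exact ⟨QuotientGroup.mk z, rfl⟩

/-- INTERFACE, Def 4.9 (v) p. 157: "the units `(‡D^⊢_w)^×` … form a topological group [noncanonically
isomorphic to `S¹`], … related to the above inductive system of units via a system of compatible
surjections `(‡D^⊢_w)^× ↠ O^{×μ_N}(A)` [i.e., where the kernel … is the subgroup of `N`-torsion] …
well-defined up to … the unique nontrivial automorphism of `(‡D^⊢_w)^×`" — "a sort of Kummer
structure". -- TODO-merge: abc-iut-L5-t3/L5-t2 ([IUTchI] Def 4.1 (iii) `TM^⊢`, Ex 3.4 (ii)).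
[cite: Mochizuki2012, Def 4.9 (v) p.157] -/
structure ArchimedeanKummerData (O : Type u) [CommMonoid O] where
  /-- `(‡D^⊢_w)^×`, "noncanonically isomorphic to `S¹`" (topology suppressed; bundled `CommGrpCat`) -/
  circle : CommGrpCat.{v}
  /-- the compatible surjections `(‡D^⊢_w)^× ↠ O^{×μ_N}(A)`, `N ≥ 1` -/
  proj : ∀ N : ℕ, circle →* UnitsModRoots O N
  /-- surjectivity -/
  proj_surjective : ∀ N, 0 < N → Function.Surjective (proj N)
  /-- compatibility with the transition maps -/
  proj_compatible : ∀ {N M : ℕ} (h : N ∣ M), (unitsModRootsTransition O h).comp (proj N) = proj M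
  /-- "the kernel of the displayed surjection is the subgroup of `N`-torsion" -/
  ker_proj : ∀ (N : ℕ) (z : circle), 0 < N → (proj N z = 1 ↔ z ^ N = 1)

end Archimedean

/-! ### 3. Definition 4.9 (ii)–(vi): the local data `‡F^{⊢▶×μ}_v` by type of place -/

/-- The three types of places of `V` (Def 4.9 (vi) (a)–(c) p. 157; [IUTchI] Def 3.1; TODO-merge
abc-iut-L5-t2). [cite: Mochizuki2012, Def 4.9 (vi) p.157] -/
inductive PlaceKind
  | bad
  | goodNonarch
  | arch
  deriving DecidableEq

/-- The integer "`2l`" of Def 4.9 (ii) p. 155 at a bad place, "`1`" (no roots adjoined: `O^⊥ :=`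
the splitting image) at a good nonarchimedean place, Def 4.9 (iv) p. 156 — as a function of the
prime `l` of the initial Θ-data and the type of the place (archimedean places do not use it).
[cite: Mochizuki2012, Def 4.9 (iv) p.156] -/
def torsionOrder (l : ℕ) : PlaceKind → ℕ
  | .bad => 2 * l
  | .goodNonarch => 1
  | .arch => 1

/-- INTERFACE: the local datum `‡F^{⊢▶×μ}_w` at a NONARCHIMEDEAN place of type `k` ([IUTchII] Def 4.9
(ii)–(iv) pp. 155–156), over the prime `l` and the group-theoretic units `X = (‡G ↷ O^×(‡G))` of Example
1.8 (iii) (`GroupTheoreticUnits` of `KummerStructures`): the monoid `O^▷(‡A)` with `‡G`-action, the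
splitting image, the presentation `O^⊥/μ_{2l} = O^▷/O^×` (split Frobenioid) with `2l`, resp. `1`, FORCED
by the type of the place (`torsionOrder`), and the REAL `×`- and `×μ`-Kummer structures `‡κ^{⊢×}_w`
(`KummerTimes`, "the unique `Ẑ^×`-orbit", Remark 1.11.1 (b)) and `‡κ^{⊢×μ}_w` (`KummerTimesMu`). The
resulting "model Frobenioid [cf. [FrdI], Theorem 5.2, (ii)] equipped with a splitting" is the
split-`×μ`-Kummer Frobenioid `‡F^{⊢▶×μ}_w`. -- TODO-merge: abc-iut-L1-t2 ([FrdI] Thm 5.2 model Frobenioids).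
[cite: Mochizuki2012, Def 4.9 (iii) p.155] -/
structure NonarchTriMuDatum (l : ℕ) (k : PlaceKind) (G : Type u) [Group G]
    (X : GroupTheoreticUnits.{u, w} G) where
  /-- `O^▷(‡A)` (bundled `CommMonCat`) -/
  O : CommMonCat.{v}
  /-- `‡G ↷ O^▷(‡A)` -/
  act : G →* MulAut O
  /-- the image of the splitting(s) of the split Frobenioid `‡F^⊢_w` -/
  splitting : Submonoid O
  /-- `O^⊥/μ_{2l}` (bad) resp. `O^⊥ = splitting` (good) presents `O^▷/O^×` (split Frobenioid) -/
  presents : OPerpPresentsAssociates O (torsionOrder l k) splitting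
  /-- `‡κ^{⊢×}_w : O^×(‡G) ⥲ O^×(‡A)`, the unique `Ẑ^×`-orbit (Def 4.9 (i) `KummerTimes`) -/
  kummerTimes : KummerTimes X ⟨O, act⟩
  /-- `‡κ^{⊢×μ}_w : O^{×μ}(‡G) ⥲ O^{×μ}(‡A)`, the induced `Ism`-orbit (Def 4.9 (i) `KummerTimesMu`) -/
  kummerTimesMu : KummerTimesMu X ⟨O, act⟩

namespace NonarchTriMuDatum

variable {l : ℕ} {k : PlaceKind} {G : Type u} [Group G] {X : GroupTheoreticUnits.{u, w} G}
  (D : NonarchTriMuDatum.{u, v, w} l k G X)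

/-- The underlying `‡G ↷ O^▷(‡A)` as a `CoveringMonoid` (Def 4.9 (i)). [cite: Mochizuki2012, Def 4.9 (ii) p.155] -/
abbrev covering : CoveringMonoid.{u, v} G := ⟨D.O, D.act⟩

/-- "by abuse of notation" `‡F^⊢_w` also denotes the split-`×`-Kummer Frobenioid determined by
`‡κ^{⊢×}_w` ([IUTchII] Def 4.9 (iii) p. 156, (iv) pp. 156–157). [cite: Mochizuki2012, Def 4.9 (iii) p.156] -/
def splitKummerTimes : SplitKummerTimesFrobenioid X :=
  ⟨⟨D.covering, D.splitting⟩, D.kummerTimes⟩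

/-- `‡F^{⊢▶×μ}_w` as a split-`×μ`-Kummer Frobenioid ([IUTchII] Def 4.9 (iii) p. 155, (iv) p. 156): the
splitting image together with `‡κ^{⊢×μ}_w`. [cite: Mochizuki2012, Def 4.9 (iii) p.155] -/
def splitKummerTimesMu : SplitKummerTimesMuFrobenioid X :=
  ⟨⟨D.covering, D.splitting⟩, D.kummerTimesMu⟩

/-- `O^⊥(‡A)` of the datum (Def 4.9 (ii)/(iv)). [cite: Mochizuki2012, Def 4.9 (ii) p.155] -/
def perp : Submonoid D.O := OPerp D.O (torsionOrder l k) D.splitting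

/-- At a good nonarchimedean place `O^⊥(‡A)` is the splitting image (Def 4.9 (iv) p. 156).
[cite: Mochizuki2012, Def 4.9 (iv) p.156] -/
theorem perp_good (D : NonarchTriMuDatum.{u, v, w} l PlaceKind.goodNonarch G X) :
    D.perp = D.splitting := OPerp_one D.O D.splitting

/-- `O^{▶×μ}(‡A)`: the monoid at `‡A` of `‡F^{⊢▶×μ}_w` (Def 4.9 (iii) p. 155 "may be naturally identified with
… `O^{▶×μ}(‡A)`"). [cite: Mochizuki2012, Def 4.9 (iii) p.155] -/
abbrev TriTimesMu : Type v := OTriTimesMu D.O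

/-- The units of `‡F^{⊢×μ}_w` (Def 4.9 (vi) p. 157, "trivial splittings"): `O^{×μ}(‡A)`; those of `‡F^{⊢×}_w`
are `(D.O)ˣ`. [cite: Mochizuki2012, Def 4.9 (vi) p.157] -/
abbrev UnitsMu : Type v := UnitsModTorsion D.O

end NonarchTriMuDatum

/-- INTERFACE: the local datum `‡F^{⊢▶×μ}_w` at an ARCHIMEDEAN place ([IUTchII] Def 4.9 (v) p. 157): the
monoid of `‡F^⊢_w` with the "sort of Kummer structure" of the circle `(‡D^⊢_w)^×`. [cite: Mochizuki2012, Def 4.9 (v) p.157] -/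
structure ArchTriMuDatum where
  /-- `O^▷(A)` of `‡F^⊢_w` ([IUTchI] Ex 3.4 (ii); bundled `CommMonCat`) -/
  O : CommMonCat.{v}
  /-- the image of the splitting -/
  splitting : Submonoid O
  /-- the circle with its projections -/
  kummer : ArchimedeanKummerData.{v, v} O

/-! ### 4. Definition 4.9 (vi)–(viii): prime-strips and the pilot object (pp. 157–158) -/

/-- INTERFACE: what Def 4.9 uses of the initial Θ-data's places — on the (finite) type `V`, the
type of each place and `V^bad ≠ ∅` ([IUTchI] Def 3.1 (b),(c); Def 4.9 (viii) p. 158), and the prime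
`l`. (abc-iut-L6-t3's `Literature.IUT.LogThetaLattice.PlaceWeights` records the same partition plus
the numerical data `deg`, `log p_v`, `ord_v(q_v)` of [IUTchIII] Rmk 2.4.2 (ii); Def 4.9 needs only the
partition and `l`, so we do not require those fields here — TODO-merge: `PlaceData.ofWeights`.)
-- TODO-merge: abc-iut-L5-t2 ([IUTchI] Def 3.1). [cite: Mochizuki2012, Def 4.9 (vi) p.157] -/
structure PlaceData (V : Type u) where
  /-- the prime `l ≥ 5` of the initial Θ-data -/
  ell : ℕ
  /-- the type of each place -/
  kind : V → PlaceKind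
  /-- `V^bad ≠ ∅` ([IUTchI] Def 3.1 (b)) -/
  bad_nonempty : ∃ v, kind v = PlaceKind.bad

/-- The local datum of an `F^{⊢▶×μ}`-prime-strip at a place of type `k`, by cases (a) bad / (b) good
nonarchimedean / (c) archimedean ([IUTchII] Def 4.9 (vi) p. 157).
[cite: Mochizuki2012, Def 4.9 (vi) p.157] -/
inductive LocalTriMuDatum (l : ℕ) (G : Type u) [Group G] (X : GroupTheoreticUnits.{u, w} G) :
    PlaceKind → Type (max u (v + 1) w)
  /-- (a) `v ∈ V^bad` (Def 4.9 (iii)) -/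
  | bad (D : NonarchTriMuDatum.{u, v, w} l PlaceKind.bad G X) : LocalTriMuDatum l G X PlaceKind.bad
  /-- (b) `v ∈ V^good ∩ V^non` (Def 4.9 (iv)) -/
  | good (D : NonarchTriMuDatum.{u, v, w} l PlaceKind.goodNonarch G X) :
      LocalTriMuDatum l G X PlaceKind.goodNonarch
  /-- (c) `v ∈ V^arc` (Def 4.9 (v)) -/
  | arch (D : ArchTriMuDatum.{v}) : LocalTriMuDatum l G X PlaceKind.arch

/-- The monoid `O^▷(−)` underlying a local datum. [cite: Mochizuki2012, Def 4.9 (vi) p.157] -/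
def LocalTriMuDatum.O {l : ℕ} {G : Type u} [Group G] {X : GroupTheoreticUnits.{u, w} G} :
    {k : PlaceKind} → LocalTriMuDatum.{u, v, w} l G X k → CommMonCat.{v}
  | _, .bad D => D.O
  | _, .good D => D.O
  | _, .arch D => D.O

/-- An **`F^{⊢▶×μ}`-prime-strip** ([IUTchII] Def 4.9 (vi)–(vii) pp. 157–158): "a collection of data
`*F^{⊢▶×μ} = {*F^{⊢▶×μ}_v}_{v ∈ V}` such that for each `v ∈ V`, `*F^{⊢▶×μ}_v` is a collection of data that
is isomorphic to `‡F^{⊢▶×μ}_v`", the local data matching the type of each place (and `2l`/`1` forced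
by it). (The `F^{⊢×}`- and `F^{⊢×μ}`-prime-strips of (vi)–(vii) are obtained by passing to
`(−)ˣ`/`UnitsMu` at each `v`. The CATEGORY of such strips — "morphisms = collections of
isomorphisms indexed by `V`" — is abc-iut-L6-t3's generic
`Literature.IUT.LogThetaLattice.StripCat` applied to these local data; TODO-merge:L6-t3.)
[cite: Mochizuki2012, Def 4.9 (vii) p.158] -/
structure FTriMuPrimeStrip {V : Type u} (P : PlaceData V) (G : V → Type u) [∀ v, Group (G v)]
    (X : ∀ v, GroupTheoreticUnits.{u, w} (G v)) where
  /-- `*F^{⊢▶×μ}_v`, a local datum of the type of the place `v` -/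
  localDatum : ∀ v : V, LocalTriMuDatum.{u, v, w} P.ell (G v) (X v) (P.kind v)

/-- INTERFACE for the global realified Frobenioid of an `F^{⊩}`- or `F^{⊩▶×μ}`-prime-strip ([IUTchI]
Def 5.2 (iv) (a)–(f); [FrdI] Ex 6.3, Thm 6.4: objects carry an "arithmetic degree" and there are
divisor submonoids `Φ_{C^⊩,v} ≅ ℝ_{≥0}` at the primes `Prime(C^⊩) ⥲ V`). Recorded with its objects,
isomorphism relation, arithmetic degree and its local components.
-- TODO-merge: abc-iut-L5-t4 ([IUTchI] Def 5.2 (iv)), abc-iut-L1-t3 ([FrdI] Ex 6.3, Thm 6.4).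
[cite: Mochizuki2012, Def 4.9 (viii) p.158] -/
structure RealifiedGlobalFrobenioid (V : Type u) [Fintype V] where
  /-- objects of `*C^⊩` -/
  Obj : Type v
  /-- isomorphism of objects -/
  Iso : Obj → Obj → Prop
  /-- the arithmetic degree of an object ([FrdI] Thm 6.4 (i),(ii)) -/
  deg : Obj → ℝ
  /-- isomorphic objects have equal degree -/
  deg_iso : ∀ a b, Iso a b → deg a = deg b
  /-- `Prime(*C^⊩) ⥲ V`: the local components of the degree -/
  localDeg : Obj → V → ℝ
  /-- the degree is the sum of local contributions -/
  deg_eq_sum : ∀ a, deg a = ∑ v, localDeg a v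

/-- An **`F^{⊩▶×μ}`-prime-strip** ([IUTchII] Def 4.9 (viii) p. 158): "a collection of data
`*F^{⊩▶×μ} = (*C^⊩, Prime(*C^⊩) ⥲ V, *F^{⊢▶×μ}, {*ρ_v}_{v ∈ V})` satisfying the conditions (a), (b), (c),
(d), (e), (f) of [IUTchI], Definition 5.2, (iv)" (abc-iut-L5-t4's predicate, to be taken as a
hypothesis where consumed — TODO-merge; deliberately no `Prop` field here), with its **pilot object**:
"the generators of the monoids «`O^▶(−)`» [each … abstractly isomorphic to `ℕ`] of the data at
`v ∈ V^bad (≠ ∅)` …, together with the `{*ρ_w}_{w ∈ V}`, determine a well-defined object, up to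
isomorphism, of … `*C^⊩` of negative «arithmetic degree»": `rho v` is a monoid homomorphism
`O^▶(−)_v → (ℝ_{≥0}, +)`, `triGen v` the generator at bad `v` (positive under `rho`), and the pilot
object's local degrees ARE `−rho(triGen)` at bad `v`, `0` elsewhere (`pilot_deg_neg` PROVED).
[cite: Mochizuki2012, Def 4.9 (viii) p.158] -/
structure FVdashTriMuPrimeStrip {V : Type u} [Fintype V] (P : PlaceData V) (G : V → Type u)
    [∀ v, Group (G v)] (X : ∀ v, GroupTheoreticUnits.{u, w} (G v)) where
  /-- `*C^⊩` with `Prime(*C^⊩) ⥲ V` -/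
  realified : RealifiedGlobalFrobenioid.{u, v} V
  /-- `*F^{⊢▶×μ}` -/
  strip : FTriMuPrimeStrip.{u, v, w} P G X
  /-- `{*ρ_v}_{v ∈ V}` read on `O^▶(−)_v`: a monoid homomorphism into `(ℝ_{≥0}, +)` -/
  rho : ∀ v : V, OTri ((strip.localDatum v).O) →* Multiplicative NNReal
  /-- the generator of `O^▶(−)_v ≅ ℕ` at a bad place -/
  triGen : ∀ v : V, P.kind v = PlaceKind.bad → OTri ((strip.localDatum v).O)
  /-- the generator has positive `rho` (it is "abstractly isomorphic to `ℕ`", not trivial) -/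
  rho_triGen_pos : ∀ (v : V) (h : P.kind v = PlaceKind.bad), 0 < Multiplicative.toAdd (rho v (triGen v h))
  /-- the pilot object (well-defined up to isomorphism) -/
  pilot : realified.Obj
  /-- its local degree at a bad place is `−ρ_v(generator of O^▶)` … -/
  pilot_localDeg_bad : ∀ (v : V) (h : P.kind v = PlaceKind.bad),
    realified.localDeg pilot v = -((Multiplicative.toAdd (rho v (triGen v h)) : NNReal) : ℝ)
  /-- … and `0` at the other places -/
  pilot_localDeg_other : ∀ v : V, P.kind v ≠ PlaceKind.bad → realified.localDeg pilot v = 0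

namespace FVdashTriMuPrimeStrip

variable {V : Type u} [Fintype V] {P : PlaceData V} {G : V → Type u} [∀ v, Group (G v)]
  {X : ∀ v, GroupTheoreticUnits.{u, w} (G v)} (S : FVdashTriMuPrimeStrip.{u, v, w} P G X)

/-- The pilot object's local degree is nonpositive everywhere. [cite: Mochizuki2012, Def 4.9 (viii) p.158] -/
theorem pilot_localDeg_nonpos (v : V) : S.realified.localDeg S.pilot v ≤ 0 := by
  by_cases h : P.kind v = PlaceKind.bad
  · rw [S.pilot_localDeg_bad v h]; exact neg_nonpos.mpr (NNReal.coe_nonneg _)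
  · rw [S.pilot_localDeg_other v h]

/-- **Def 4.9 (viii) p. 158: the pilot object is "of negative «arithmetic degree»"** — PROVED from the
local degrees and `V^bad ≠ ∅`. [cite: Mochizuki2012, Def 4.9 (viii) p.158] -/
theorem pilot_deg_neg : S.realified.deg S.pilot < 0 := by
  obtain ⟨v₀, hv₀⟩ := P.bad_nonempty
  rw [S.realified.deg_eq_sum]
  have hlt : S.realified.localDeg S.pilot v₀ < 0 := by
    rw [S.pilot_localDeg_bad v₀ hv₀]
    have h0 : (0 : ℝ) < ((Multiplicative.toAdd (S.rho v₀ (S.triGen v₀ hv₀)) : NNReal) : ℝ) :=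
      NNReal.coe_pos.mpr (S.rho_triGen_pos v₀ hv₀)
    linarith
  calc ∑ v, S.realified.localDeg S.pilot v
      < ∑ v, (0 : ℝ) := Finset.sum_lt_sum (fun v _ => S.pilot_localDeg_nonpos v)
          ⟨v₀, Finset.mem_univ _, hlt⟩
    _ = 0 := by simp

end FVdashTriMuPrimeStrip

/-- An **isomorphism of `F^{⊩▶×μ}`-prime-strips** ("an isomorphism between collections of data as
discussed above", [IUTchII] Def 4.9 (viii) p. 158), at the level recorded here: a bijection of the
objects of the realified Frobenioids respecting isomorphism classes and degrees and carrying pilot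
object to pilot object, together with a `V`-indexed family of identifications of the local data
(`localIso`, over an abstract local isomorphism relation — the strip-category morphisms of
abc-iut-L6-t3's `StripCat`; TODO-merge). [cite: Mochizuki2012, Def 4.9 (viii) p.158] -/
structure FVdashTriMuIso {V : Type u} [Fintype V] {P : PlaceData V} {G : V → Type u} [∀ v, Group (G v)]
    {X : ∀ v, GroupTheoreticUnits.{u, w} (G v)}
    (LocalIso : ∀ v, LocalTriMuDatum.{u, v, w} P.ell (G v) (X v) (P.kind v) →
      LocalTriMuDatum.{u, v, w} P.ell (G v) (X v) (P.kind v) → Prop)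
    (S T : FVdashTriMuPrimeStrip.{u, v, w} P G X) where
  /-- bijection on objects of `*C^⊩` -/
  objEquiv : S.realified.Obj ≃ T.realified.Obj
  /-- it respects isomorphism classes -/
  map_iso : ∀ a b, S.realified.Iso a b ↔ T.realified.Iso (objEquiv a) (objEquiv b)
  /-- it preserves arithmetic degrees -/
  deg_eq : ∀ a, T.realified.deg (objEquiv a) = S.realified.deg a
  /-- pilot object goes to pilot object, up to isomorphism -/
  map_pilot : T.realified.Iso (objEquiv S.pilot) T.pilot
  /-- the local data are identified place by place -/
  localIso : ∀ v, LocalIso v (S.strip.localDatum v) (T.strip.localDatum v)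

/-- An isomorphism of `F^{⊩▶×μ}`-prime-strips identifies the (negative) degrees of the pilot objects.
[cite: Mochizuki2012, Def 4.9 (viii) p.158] -/
theorem FVdashTriMuIso.pilot_deg_eq {V : Type u} [Fintype V] {P : PlaceData V} {G : V → Type u}
    [∀ v, Group (G v)] {X : ∀ v, GroupTheoreticUnits.{u, w} (G v)}
    {LocalIso : ∀ v, LocalTriMuDatum.{u, v, w} P.ell (G v) (X v) (P.kind v) →
      LocalTriMuDatum.{u, v, w} P.ell (G v) (X v) (P.kind v) → Prop}
    {S T : FVdashTriMuPrimeStrip.{u, v, w} P G X} (e : FVdashTriMuIso LocalIso S T) :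
    S.realified.deg S.pilot = T.realified.deg T.pilot := by
  rw [← e.deg_eq S.pilot]
  exact T.realified.deg_iso _ _ e.map_pilot

end Literature.IUT.HodgeArakelov
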